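import Summits.PneNP.PneNP.Theorems.OneSliceSingleThresholdTwoRoundTransfer

/-!
# The dose transfer `RelativeSparseDose(c+1) + invisible dose → SingleThreshold(c)`

Route `OneSlice`, crux `Summit.PneNP.PneNP.Theses.OneSlice.SingleThreshold` (stmt-PneNP-2833), line
`two-round-exposure`: the registered stub `stub_doseTransfer` (stub F), a variant of the landed
lever `stub_twoRoundTransfer` (`OneSliceSingleThresholdTwoRoundTransfer.lean`) with a fresh
independent DOSE `R ∼ G(n, ρ)`, `ρ = n^{-σ}`, in place of the bare second round.

**What.** Fix `c`, `k ≥ 5`, `ε > 0`, `σ > 1 + 1/(k-1)`; write `p = p_c = n^{-2/(k-1)}` (`pc n k`),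
`q = pMinus k ε n ≤ p` (sprinkle density), `ρ = n^{-σ}` (dose density) and `a ⊕ b = a + b − ab`.
HYPOTHESES: (RSD) for every `γ > 0`, eventually in `n`, every monotone `{∧₂, ∨₂, 0, 1}`-circuit `D`
of size `≤ n^{c+1}` has RELATIVE sparse-dose advantage
`E_{S,A} D(S ∪ K_A) − E_{S,R} D(S ∪ R) ≤ γ` (`S ∼ G(n,q)`, `R ∼ G(n,ρ)`, `A` a uniform `k`-set);
(TV) `Σ_z |w_{p ⊕ ρ}(z) − w_p(z)| → 0` (the dose is invisible at the critical density).
CONCLUSION: `∃ δ > 0`, eventually in `n`, every monotone `{∧₂, ∨₂}`-circuit `C` with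
`Pr_p[C ≠ CLIQUE_k] ≤ δ` has more than `n^c` gates (`LowerBoundAt c k δ`, the crux's matrix).

**How.** As in the two-round transfer: with `κ₀ = e^{-2} ≤ Pr_p[ω_k = 0]`, `κ₁ ≤ Pr_p[ω_k = 1]`
eventually and `TV₂₃ → 0` (Lemma 23), a `δ = κ₀κ₁/8`-accurate monotone `C` of size `≤ n^c` has
advantage `adv_p(C) = Σ_z w_p(z)·Pr_A[C(z ∪ K_A)] − Pr_p[C = 1] ≥ κ₀/2` (`adv_lower_bound`). On the
other hand `adv_p(C) = T₁ + T₂` with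
* `T₁ = Σ_z w_p(z)·Pr_A[C(z ∪ K_A)] − Σ_z Σ_y w_p(z) w_ρ(y) [C(z ∪ y)]`: by the union law
  `G(n,p₁) ∪ G(n,q) ∼ G(n, p₁ ⊕ q)` (`sum_sum_gnpWeight_mul_sup`) at `p₁ = (p−q)/(1−q)`,
  `p₁ ⊕ q = p`, `T₁` is the `w_{p₁}`-average over the first round `x` of the relative sparse-dose
  advantages of the restrictions `C^x = C(x ∪ ·)` (`Circuit.exists_restrict_sup`, one more gate,
  size `≤ n^c + 1 ≤ n^{c+1}`), each `≤ γ = κ₀/8` eventually by (RSD) (`adv_dose_le`);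
* `T₂ = Σ_z Σ_y w_p(z) w_ρ(y) [C(z ∪ y)] − Pr_p[C = 1] = Pr_{p ⊕ ρ}[C = 1] − Pr_p[C = 1]`
  (union law again, `sum_sum_gnpWeight_ite_sup`) `≤ Σ_z |w_{p⊕ρ}(z) − w_p(z)| ≤ κ₀/8` eventually by
  (TV) (`dose_sub_le_tv`).
So `κ₀/2 ≤ adv_p(C) ≤ κ₀/4`, a contradiction.

## References

* B. Rossman, *The monotone complexity of k-clique on random graphs*, FOCS 2010, 193–201; SIAM J.
  Comput. 43 (2014) 256–279 — §7 (p. 10) and Appendix B (Lemmas 17 and 23, pp. 13–14)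
  [Rossman2010].
-/

noncomputable section

set_option linter.dupNamespace false

open Finset Filter

open scoped Classical Topology

namespace Summit.PneNP.PneNP.Theorems.SingleThreshold

open Literature.Computability.Complexity GateList
open Summit.PneNP.PneNP.Theorems.SingleThreshold.Negative (Edges pc err LowerBoundAt pc_nonneg
  pc_le_one tendsto_pc gnpProb_union_le)

/-! ### The dose at a fixed density: `Pr_{p ⊕ ρ}[f = 1] − Pr_p[f = 1] ≤ TV` -/

/-- **Adding an independent dose changes acceptance by at most the total variation.** For
`G ∼ G(n,p)` and an independent dose `R ∼ G(n,ρ)`, `G ∪ R ∼ G(n, p + ρ − pρ)` (union law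
`sum_sum_gnpWeight_ite_sup`), so `Pr[f(G ∪ R) = 1] − Pr[f(G) = 1] ≤ Σ_z |w_{p+ρ−pρ}(z) − w_p(z)|`.
[folklore] -/
theorem dose_sub_le_tv {n : ℕ} (p ρ : ℝ) (f : (Edges n → Bool) → Bool) :
    (∑ z : Edges n → Bool, ∑ y : Edges n → Bool,
        gnpWeight n p z * gnpWeight n ρ y * (if f (z ⊔ y) = true then (1 : ℝ) else 0)) -
      gnpProb n p (univ.filter fun z => f z = true) ≤
    ∑ z : Edges n → Bool, |gnpWeight n (p + ρ - p * ρ) z - gnpWeight n p z| := by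
  rw [sum_sum_gnpWeight_ite_sup p ρ (fun z => f z = true), gnpProb_filter, gnpProb_filter,
    ← sum_sub_distrib]
  refine sum_le_sum fun z _ => ?_
  split_ifs
  · exact le_abs_self _
  · rw [sub_self]; exact abs_nonneg _

/-! ### The relative advantage through the union law (two-round exposure with a dose) -/

/-- **Two-round exposure of the relative sparse-dose advantage.** If `G(n, p₁+q−p₁q) = H' ∪ S` with
independent `H' ∼ G(n,p₁)`, `S ∼ G(n,q)` (union law `sum_sum_gnpWeight_mul_sup`), then for a
monotone `{∧₂,∨₂,0,1}`-circuit `C` and any dose density `ρ` the relative advantage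
`Σ_z w_{p₁⊕q}(z)·Pr_A[C(z ∪ K_A)] − Σ_z Σ_y w_{p₁⊕q}(z) w_ρ(y) [C(z ∪ y)]` is the `w_{p₁}`-average
over `H'` of the same quantity at density `q` for the restrictions `C^{H'} = C(H' ∪ ·)`
(`Circuit.exists_restrict_sup`, at most one more gate); hence it is at most any common bound `γ` of
the latter. [cite: Rossman2010, §7 (proof of Thm 2, p. 10) and App. B (proof of Lemma 17, p. 14)] -/
theorem adv_dose_le {n k : ℕ} {p₁ q γ : ℝ} (ρ : ℝ) (hp0 : 0 ≤ p₁) (hp1 : p₁ ≤ 1)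
    (C : Circuit (Edges n)) (hC : C.IsOver monotoneBasis01)
    (h : ∀ D : Circuit (Edges n), D.IsOver monotoneBasis01 → D.size ≤ C.size + 1 →
      (∑ s : Edges n → Bool, gnpWeight n q s *
          kSubsetProb n k (fun A => D.eval (s ⊔ cliqueVec A) = true)) -
        (∑ s : Edges n → Bool, ∑ y : Edges n → Bool,
            gnpWeight n q s * gnpWeight n ρ y *
              (if D.eval (s ⊔ y) = true then (1 : ℝ) else 0)) ≤ γ) :
    (∑ z : Edges n → Bool, gnpWeight n (p₁ + q - p₁ * q) z *
        kSubsetProb n k (fun A => C.eval (z ⊔ cliqueVec A) = true)) -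
      (∑ z : Edges n → Bool, ∑ y : Edges n → Bool,
          gnpWeight n (p₁ + q - p₁ * q) z * gnpWeight n ρ y *
            (if C.eval (z ⊔ y) = true then (1 : ℝ) else 0)) ≤ γ := by
  -- the union law for the difference `F − G` of the two test functionals
  have e := sum_sum_gnpWeight_mul_sup (n := n) p₁ q (fun z =>
    kSubsetProb n k (fun A => C.eval (z ⊔ cliqueVec A) = true) -
      ∑ y : Edges n → Bool, gnpWeight n ρ y * (if C.eval (z ⊔ y) = true then (1 : ℝ) else 0))
  -- the relative advantage of the restriction `C^x`, for every first round `x`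
  have hx : ∀ x : Edges n → Bool,
      ∑ s : Edges n → Bool, gnpWeight n q s *
        (kSubsetProb n k (fun A => C.eval ((x ⊔ s) ⊔ cliqueVec A) = true) -
          ∑ y : Edges n → Bool, gnpWeight n ρ y *
            (if C.eval ((x ⊔ s) ⊔ y) = true then (1 : ℝ) else 0)) ≤ γ := by
    intro x
    obtain ⟨D, hD, hDsize, hDeval⟩ := C.exists_restrict_sup hC x
    have ha : ∀ s : Edges n → Bool,
        kSubsetProb n k (fun A => C.eval ((x ⊔ s) ⊔ cliqueVec A) = true) =
          kSubsetProb n k (fun A => D.eval (s ⊔ cliqueVec A) = true) := fun s =>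
      kSubsetProb_congr fun A => by rw [hDeval, sup_assoc]
    have hb : ∀ s y : Edges n → Bool, (if C.eval ((x ⊔ s) ⊔ y) = true then (1 : ℝ) else 0) =
        (if D.eval (s ⊔ y) = true then (1 : ℝ) else 0) := fun s y => by
      rw [hDeval, sup_assoc]
    simp_rw [ha, hb]
    refine le_of_eq_of_le ?_ (h D hD hDsize)
    rw [← sum_sub_distrib]
    refine sum_congr rfl fun s _ => ?_
    rw [mul_sub, mul_sum]
    refine congrArg₂ _ rfl (sum_congr rfl fun y _ => ?_)
    ring
  calc (∑ z : Edges n → Bool, gnpWeight n (p₁ + q - p₁ * q) z *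
        kSubsetProb n k (fun A => C.eval (z ⊔ cliqueVec A) = true)) -
      (∑ z : Edges n → Bool, ∑ y : Edges n → Bool,
          gnpWeight n (p₁ + q - p₁ * q) z * gnpWeight n ρ y *
            (if C.eval (z ⊔ y) = true then (1 : ℝ) else 0))
      = ∑ z : Edges n → Bool, gnpWeight n (p₁ + q - p₁ * q) z *
          (kSubsetProb n k (fun A => C.eval (z ⊔ cliqueVec A) = true) -
            ∑ y : Edges n → Bool, gnpWeight n ρ y *
              (if C.eval (z ⊔ y) = true then (1 : ℝ) else 0)) := by
        rw [← sum_sub_distrib]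
        refine sum_congr rfl fun z _ => ?_
        rw [mul_sub, mul_sum]
        refine congrArg₂ _ rfl (sum_congr rfl fun y _ => ?_)
        ring
    _ = ∑ x : Edges n → Bool, gnpWeight n p₁ x * ∑ s : Edges n → Bool, gnpWeight n q s *
          (kSubsetProb n k (fun A => C.eval ((x ⊔ s) ⊔ cliqueVec A) = true) -
            ∑ y : Edges n → Bool, gnpWeight n ρ y *
              (if C.eval ((x ⊔ s) ⊔ y) = true then (1 : ℝ) else 0)) := by
        rw [← e]
        refine sum_congr rfl fun x _ => ?_
        rw [mul_sum]
        refine sum_congr rfl fun s _ => ?_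
        ring
    _ ≤ ∑ x : Edges n → Bool, gnpWeight n p₁ x * γ :=
        sum_le_sum fun x _ => mul_le_mul_of_nonneg_left (hx x) (gnpWeight_nonneg hp0 hp1 x)
    _ = γ := by rw [← sum_mul, sum_gnpWeight, one_mul]

/-! ### The transfer -/

/-- **Dose transfer `RelativeSparseDose(c+1) + invisible dose → SingleThreshold(c)`** (stub
`stub_doseTransfer` of line `two-round-exposure`; Rossman 2010, §7 and App. B, with the first
exposure round in place of the fixed graph `H` and a fresh sparse dose `R ∼ G(n, n^{-σ})` in place
of the bare second round). Given `c`, `k ≥ 5`, `ε > 0`, `σ > 1 + 1/(k−1)`: if for every `γ > 0`,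
eventually in `n`, every monotone `{∧₂,∨₂,0,1}`-circuit `D` of size `≤ n^{c+1}` has
`E_{S,A} D(S ∪ K_A) − E_{S,R} D(S ∪ R) ≤ γ` (`S ∼ G(n, pMinus k ε n)`, `R ∼ G(n, n^{-σ})`, `A` a
uniform `k`-set), and `Σ_z |w_{p ⊕ n^{-σ}}(z) − w_p(z)| → 0` for `p = n^{-2/(k-1)}`, then there is
`δ > 0` such that eventually every monotone `{∧₂,∨₂}`-circuit with `Pr_p[C ≠ CLIQUE_k] ≤ δ` has more
than `n^c` gates. Proof: `δ = κ₀κ₁/8`; a small accurate `C` has `adv_p(C) ≥ κ₀/2`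
(`adv_lower_bound`, Lemma 23) and `adv_p(C) = T₁ + T₂ ≤ κ₀/8 + κ₀/8` (`adv_dose_le` at
`p₁ = (p − q)/(1 − q)` with the hypothesis at `γ = κ₀/8`, and `dose_sub_le_tv` with the TV
hypothesis). [cite: Rossman2010, §7 (p. 10) and App. B (Lemmas 17 and 23, pp. 13–14)] -/
theorem stub_doseTransfer :
    ∀ (c k : ℕ) (ε σ : ℝ), 5 ≤ k → 0 < ε → 1 + 1 / ((k : ℝ) - 1) < σ →
      (∀ γ : ℝ, 0 < γ →
      ∀ᶠ n : ℕ in atTop, ∀ D : Circuit (Edges n),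
        D.IsOver monotoneBasis01 → D.size ≤ n ^ (c + 1) →
          (∑ x : Edges n → Bool, gnpWeight n (pMinus k ε n) x *
                kSubsetProb n k (fun A => D.eval (x ⊔ cliqueVec A) = true)) -
            (∑ x : Edges n → Bool, ∑ y : Edges n → Bool,
                gnpWeight n (pMinus k ε n) x * gnpWeight n ((n : ℝ) ^ (-σ)) y *
                  (if D.eval (x ⊔ y) = true then (1 : ℝ) else 0)) ≤ γ) →
      Tendsto (fun n : ℕ => ∑ z : Edges n → Bool,
        |gnpWeight n (pc n k + (n : ℝ) ^ (-σ) - pc n k * (n : ℝ) ^ (-σ)) z - gnpWeight n (pc n k) z|)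
        atTop (𝓝 0) →
      ∃ δ : ℝ, 0 < δ ∧ ∀ᶠ n : ℕ in Filter.atTop,
        ∀ C : Literature.Computability.Complexity.Circuit ((⊤ : SimpleGraph (Fin n)).edgeSet),
          C.IsOver Literature.Computability.Complexity.monotoneBasis →
            (Finset.univ.filter (fun x : ((⊤ : SimpleGraph (Fin n)).edgeSet) → Bool =>
                C.eval x ≠ decide (¬ (SimpleGraph.fromEdgeSet {e : Sym2 (Fin n) |
                  ∃ h : e ∈ (⊤ : SimpleGraph (Fin n)).edgeSet, x ⟨e, h⟩ = true}).CliqueFree k))).sum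
              (fun x => ((n : ℝ) ^ (-(2 : ℝ) / ((k : ℝ) - 1))) ^ (Finset.univ.filter (fun e => x e = true)).card *
                (1 - (n : ℝ) ^ (-(2 : ℝ) / ((k : ℝ) - 1))) ^
                  (n.choose 2 - (Finset.univ.filter (fun e => x e = true)).card)) ≤ δ →
            n ^ c < C.size := by
  intro c k ε σ hk hε _hσ hN hT
  suffices h : ∃ δ : ℝ, 0 < δ ∧ LowerBoundAt c k δ by exact h
  have hk2 : 2 ≤ k := le_trans (by norm_num) hk
  -- the two threshold constants `κ₀ ≤ Pr[ω_k = 0]`, `κ₁ ≤ Pr[ω_k = 1]`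
  set κ₀ : ℝ := Real.exp (-(2 * (1 : ℝ) ^ k.choose 2)) with hκ₀
  set κ₁ : ℝ := (1 : ℝ) ^ k.choose 2 / (2 ^ k * k.factorial) *
    Real.exp (-(2 * (k * 2 ^ k * (1 : ℝ) ^ k.choose 2))) with hκ₁
  have hκ₀pos : 0 < κ₀ := Real.exp_pos _
  have hκ₁pos : 0 < κ₁ := by positivity
  refine ⟨κ₀ * κ₁ / 8, by positivity, ?_⟩
  -- the critical density as a threshold function
  have hp01 : ∀ n : ℕ, 0 ≤ pc n k ∧ pc n k ≤ 1 := fun n => ⟨pc_nonneg n k, pc_le_one' n hk2⟩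
  have hab : ∀ᶠ n : ℕ in atTop, 1 * (n : ℝ) ^ (-(2 : ℝ) / ((k : ℝ) - 1)) ≤ pc n k ∧
      pc n k ≤ 1 * (n : ℝ) ^ (-(2 : ℝ) / ((k : ℝ) - 1)) :=
    Eventually.of_forall fun n => by rw [one_mul]; exact ⟨le_rfl, le_rfl⟩
  have hpb : ∀ᶠ n : ℕ in atTop, 0 ≤ pc n k ∧ pc n k ≤ 1 * (n : ℝ) ^ (-(2 : ℝ) / ((k : ℝ) - 1)) :=
    hab.mono fun n hn => ⟨pc_nonneg n k, hn.2⟩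
  have hA : ∀ᶠ n : ℕ in atTop,
      κ₀ ≤ gnpProb n (pc n k) (univ.filter fun x => cliqueCount n k x = 0) :=
    eventually_le_gnpProb_cliqueFree (p := fun n => pc n k) hk2 le_rfl hpb
  have hE1 : ∀ᶠ n : ℕ in atTop,
      κ₁ ≤ gnpProb n (pc n k) (univ.filter fun x => cliqueCount n k x = 1) :=
    eventually_le_gnpProb_cliqueCount_eq_one (p := fun n => pc n k) hk2 one_pos le_rfl hab
  -- Lemma 23
  have hTV : Tendsto (fun n => ∑ H : Edges n → Bool,
      |condOneCliqueLaw n k (pc n k) H - plantedCliqueFreeLaw n k (pc n k) H|) atTop (𝓝 0) :=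
    Rossman2010_plantedVsConditioned_holds k hk (fun n => pc n k) hp01
      (Asymptotics.isTheta_refl _ _)
  have hTVev : ∀ᶠ n : ℕ in atTop, ∑ H : Edges n → Bool,
      |condOneCliqueLaw n k (pc n k) H - plantedCliqueFreeLaw n k (pc n k) H| ≤ κ₀ / 8 :=
    hTV.eventually_le_const (by positivity)
  -- the dose is invisible at the critical density, eventually within `κ₀ / 8`
  have hTev : ∀ᶠ n : ℕ in atTop, ∑ z : Edges n → Bool,
      |gnpWeight n (pc n k + (n : ℝ) ^ (-σ) - pc n k * (n : ℝ) ^ (-σ)) z -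
        gnpWeight n (pc n k) z| ≤ κ₀ / 8 :=
    hT.eventually_le_const (by positivity)
  -- the hypothesis at `γ = κ₀ / 8`
  have hNγ := hN (κ₀ / 8) (by positivity)
  show ∀ᶠ n : ℕ in atTop, ∀ C : Circuit (Edges n), C.IsOver monotoneBasis →
    err n k C ≤ κ₀ * κ₁ / 8 → n ^ c < C.size
  filter_upwards [hNγ, hA, hE1, hTVev, hTev, eventually_ge_atTop k, eventually_ge_atTop 2] with n
    hNn hAn hE1n hTVn hTn hkn hn2
  intro C hC herr
  by_contra hsz
  push Not at hsz
  -- the densities `q ≤ p ≤ 1` and `p₁ = (p - q)/(1 - q)`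
  have hn1 : 1 ≤ n := by omega
  have hp0 : 0 ≤ pc n k := pc_nonneg n k
  have hp1 : pc n k ≤ 1 := pc_le_one hn1 hk2
  have hqp : pMinus k ε n ≤ pc n k := pMinus_le_pc hn1 hk2 hε.le
  have hq1 : pMinus k ε n < 1 := pMinus_lt_one hn2 hk2 hε.le
  have h1q : 0 < 1 - pMinus k ε n := by linarith
  set p₁ : ℝ := (pc n k - pMinus k ε n) / (1 - pMinus k ε n) with hp₁
  have hp₁0 : 0 ≤ p₁ := div_nonneg (by linarith) h1q.le
  have hp₁1 : p₁ ≤ 1 := by rw [hp₁, div_le_one h1q]; linarith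
  have hpp : p₁ + pMinus k ε n - p₁ * pMinus k ε n = pc n k := by
    rw [hp₁]
    field_simp
    ring
  -- `C` is monotone
  have hC01 : C.IsOver monotoneBasis01 := hC.mono monotoneBasis_subset_monotoneBasis01
  have hmono : Monotone C.eval := C.monotone_eval_of_isOver_monotoneBasis01 hC01
  -- UPPER bound on the advantage at `p`, first half `T₁`: two-round exposure and (RSD)
  have hupper₁ : (∑ z : Edges n → Bool, gnpWeight n (pc n k) z *
        kSubsetProb n k (fun A => C.eval (z ⊔ cliqueVec A) = true)) -
      (∑ z : Edges n → Bool, ∑ y : Edges n → Bool,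
          gnpWeight n (pc n k) z * gnpWeight n ((n : ℝ) ^ (-σ)) y *
            (if C.eval (z ⊔ y) = true then (1 : ℝ) else 0)) ≤ κ₀ / 8 := by
    rw [← hpp]
    refine adv_dose_le _ hp₁0 hp₁1 C hC01 fun D hD hDsize => hNn D hD ?_
    have h1 : 1 ≤ n ^ c := Nat.one_le_pow _ _ (by omega)
    calc D.size ≤ C.size + 1 := hDsize
      _ ≤ n ^ c + 1 := by omega
      _ ≤ n ^ c * n := by nlinarith
      _ = n ^ (c + 1) := (pow_succ n c).symm
  -- UPPER bound, second half `T₂`: the dose is invisible (TV)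
  have hupper₂ : (∑ z : Edges n → Bool, ∑ y : Edges n → Bool,
          gnpWeight n (pc n k) z * gnpWeight n ((n : ℝ) ^ (-σ)) y *
            (if C.eval (z ⊔ y) = true then (1 : ℝ) else 0)) -
      gnpProb n (pc n k) (univ.filter fun z => C.eval z = true) ≤ κ₀ / 8 :=
    (dose_sub_le_tv (pc n k) ((n : ℝ) ^ (-σ)) C.eval).trans hTn
  -- LOWER bound on the advantage at `p`: Lemma 17 / Lemma 23
  have hP₁ : 0 < gnpProb n (pc n k) (univ.filter fun x => cliqueCount n k x = 1) :=
    hκ₁pos.trans_le hE1n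
  have hlower := adv_lower_bound hp0 hp1 hkn C.eval hmono hP₁
  have herr' : gnpProb n (pc n k) (univ.filter fun x => C.eval x ≠ cliqueFn n k x) ≤ κ₀ * κ₁ / 8 :=
    herr
  have herr0 : 0 ≤ gnpProb n (pc n k) (univ.filter fun x => C.eval x ≠ cliqueFn n k x) :=
    gnpProb_nonneg hp0 hp1 _
  have hκ₁1 : κ₁ ≤ 1 := hE1n.trans (gnpProb_le_one hp0 hp1 _)
  have hdiv : gnpProb n (pc n k) (univ.filter fun x => C.eval x ≠ cliqueFn n k x) /
      gnpProb n (pc n k) (univ.filter fun x => cliqueCount n k x = 1) ≤ κ₀ / 8 := by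
    rw [div_le_iff₀ hP₁]
    have := mul_le_mul_of_nonneg_left hE1n (by positivity : (0 : ℝ) ≤ κ₀ / 8)
    linarith
  have h2δ : 2 * (κ₀ * κ₁ / 8) ≤ κ₀ / 4 := by nlinarith
  linarith

end Summit.PneNP.PneNP.Theorems.SingleThreshold

end
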